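import Summits.Ventures.LatticeQCDFlow.Scaling.BooleanStarOneCopyDrift

/-!
HONEST FRAMING: exact (Metropolis-corrected) sampling algorithms for lattice gauge theory; figures
of merit are autocorrelation/cost numbers at stated couplings and volumes; no continuum-physics
claim.

# BooleanStarOneCopyToolkit — THE ONE-DIMENSIONAL OBJECTS OF S9 IN CLOSED FORM: THE COUPLING BRACKET IS A DRIFT DIFFERENCE, THE DRIFT `m` HAS EXPLICIT,
# POSITIVE, DECREASING GAPS, `|m|` GROWS AT LEAST LINEARLY AWAY FROM ITS SIGN CHANGE; THE THREE-POINT IDENTITY, THE BUDGET FORM OF THE DRIFT INEQUALITY, AND THE LAW FOR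
# POTENTIALS GIVEN ON THE INTEGERS ONLY (lean-2 GEN-32, ours)

Venture-side (OURS).  Cell `lqcd-flow` (pub-lqcd), unit `pub-lqcd-lean-2-g32`, 2026-08-29.  Chapter S, file 11, on top of `BooleanStarOneCopyDrift` (S9).  Pure real
algebra in the language of S9 (`c = t/K`, `h = (1−t)w_0`, `Δ(B) = h + cB + c·rr·(K−B+1)`, `π_b(B) = cB/Δ(B)`, `π_b̄(B) = c·rr·(K−B)/Δ(B+1)`, one-copy drift
`m(B) = μ̄π_b̄(B) − μπ_b(B)` = the mean one-cycle increment of one copy's cold `b̄`-count), for whoever proves the drift inequality of S9 in the last open corner of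
OPEN-MATH item 1 (ii) on the homogeneous Boolean star (`t ≫ h`, `rr ≪ μ_0(b)`, macroscopic equilibrium pool; memo `lean-2/MEMO-gen32-certificate-largeK.md` §17–§19):

* §1 `oneCopy_den_shift` (`Δ_b̄(B) = Δ(B+1)`), `oneCopy_den_pos`, **`oneCopy_pib_sub`** (`π_b(B₂) − π_b(B₁) = c(B₂−B₁)(h + c·rr(K+1))/(Δ(B₁)Δ(B₂))`),
  **`oneCopy_pib'_sub`** (`π_b̄(B₁) − π_b̄(B₂) = c·rr(B₂−B₁)(h + c(K+1))/(Δ(B₁+1)Δ(B₂+1))`), `oneCopy_pi_bounds` (`0 ≤ π_b ≤ cB/(h+cB) ≤ 1`, `0 ≤ π_b̄ ≤ rr·cK/(h+c)`),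
  **`oneCopy_threePoint`** (`q↓∇⁻φ − q↑∇⁺φ = (q↓−q↑)·s̄ − (q↓+q↑)·κ₂/2`: drift × mean slope − step mass × half second difference), **`oneCopyDrift_of_budget`** (a per-count
  deficit bound `ρφ − d ≤ ℓ` plus a bracket bound `ρ(B₂−B₁) + ℓ(B₁) + ℓ(B₂) ≤ bracket` give the drift inequality of S9).
* §2 **`oneCopy_bracket_eq_drift_sub`** — the coupling bracket of S9 IS `m(B₁) − m(B₂)` (the expected change of `D = B_Y − B_X` is the difference of the copies' drifts);
  **`oneCopy_gap_eq`** (`g(B) = m(B) − m(B+1) = μc(h + c·rr(K+1))/(Δ(B)Δ(B+1)) + μ̄c·rr(h + c(K+1))/(Δ(B+1)Δ(B+2))`), `oneCopy_gap_pos` (`m` strictly decreasing),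
  **`oneCopy_gap_antitone`** (`g` decreasing), **`oneCopy_drift_le_above`** / **`oneCopy_drift_ge_below`** (`m(B₀+1+n) ≤ m(B₀+1) − n·g(B₀+n)`,
  `m(B₀−n) ≥ m(B₀) + n·g(B₀)`: away from any point, `m` moves by at least the number of steps times the smallest gap crossed).
* §3 **`boolStar_mixingTime_le_of_oneCopyDrift_int`** — the law of S9 for a potential constrained on the INTEGERS only (`φ(n) ≥ 0`, `|φ(n) − φ(n')| ≤ |n − n'|`,
  `φ(n) ≤ Φm` on `n ≤ K`, and the drift inequality, which only reads `φ` at integers): McShane's extension (`LipschitzOnWith.extend_real`) and a positive part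
  supply the `1`-Lipschitz `φ ≥ 0` on `ℝ` that S7's separation needs — so recursively defined potentials (second differences prescribed along the count) are admissible.

So the drift inequality of S9 reads `ρ(B₂ − B₁ + φ(B₁) + φ(B₂)) ≤ [m(B₁) − m(B₂)] + d(B₁) + d(B₂)` with `m` strictly decreasing through `0` at a unique `B* ∈ [0, K]`
(`m(0) ≥ 0 > m(K)`), `|m(B)| ≥ |B − B*|·g(max{B, ⌊B*⌋})`, and `d = |m|·|s̄| − (q↓+q↑)κ₂/2` for a convex `φ` centred at `B*` — the successor's Huber bookkeeping (memo §19;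
numerically `κ ≈ 1.6–3` in units `μ_0(b)c/(h+2t)` for `K ≤ 1600`, `numerics/one_dim.py`).  NOT CLAIMED: that bookkeeping; anything measured.  Literature grade (cell rule):
OWN, elementary; nothing cited as a fact; no new bib keys.
-/
noncomputable section

namespace Summit.Ventures.LatticeQCDFlow.Scaling

/-! ## §1 The one-copy swap probabilities: closed-form differences, monotonicity, bounds -/

/-- The two denominators are one affine function at consecutive arguments: `h + c(K−B)rr + c(B+1) = Δ(B+1)` with `Δ(B) = h + cB + c·rr·(K−B+1)`. [ours] -/
theorem oneCopy_den_shift (h c rr K B : ℝ) : h + c * (K - B) * rr + c * (B + 1) = h + c * (B + 1) + c * rr * (K - (B + 1) + 1) := by ring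

/-- `Δ(B) = h + cB + c·rr·(K−B+1) > 0` for `0 ≤ B ≤ K + 1` (`h > 0`, `c, rr ≥ 0`). [ours] -/
theorem oneCopy_den_pos {h c rr K B : ℝ} (hh : 0 < h) (hc : 0 ≤ c) (hrr : 0 ≤ rr) (hB0 : 0 ≤ B) (hBK : B ≤ K + 1) :
    0 < h + c * B + c * rr * (K - B + 1) := by
  have : 0 ≤ c * rr * (K - B + 1) := mul_nonneg (mul_nonneg hc hrr) (by linarith)
  have : 0 ≤ c * B := mul_nonneg hc hB0
  linarith

/-- **`π_b(B₂) − π_b(B₁) = c(B₂−B₁)(h + c·rr·(K+1))/(Δ(B₁)Δ(B₂))`** — `π_b` is increasing, with an explicit increment. [ours] -/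
theorem oneCopy_pib_sub {h c rr K B₁ B₂ : ℝ} {πb : ℝ → ℝ} (hπb : ∀ B, πb B = c * B / (h + c * B + c * rr * (K - B + 1)))
    (h1 : h + c * B₁ + c * rr * (K - B₁ + 1) ≠ 0) (h2 : h + c * B₂ + c * rr * (K - B₂ + 1) ≠ 0) :
    πb B₂ - πb B₁ = c * (B₂ - B₁) * (h + c * rr * (K + 1)) / ((h + c * B₁ + c * rr * (K - B₁ + 1)) * (h + c * B₂ + c * rr * (K - B₂ + 1))) := by
  rw [hπb, hπb, div_sub_div _ _ h2 h1]
  congr 1 <;> ring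

/-- **`π_b̄(B₁) − π_b̄(B₂) = c·rr·(B₂−B₁)(h + c(K+1))/(Δ(B₁+1)Δ(B₂+1))`** — `π_b̄` is decreasing, with an explicit decrement. [ours] -/
theorem oneCopy_pib'_sub {h c rr K B₁ B₂ : ℝ} {πb' : ℝ → ℝ} (hπb' : ∀ B, πb' B = c * (K - B) * rr / (h + c * (K - B) * rr + c * (B + 1)))
    (h1 : h + c * (K - B₁) * rr + c * (B₁ + 1) ≠ 0) (h2 : h + c * (K - B₂) * rr + c * (B₂ + 1) ≠ 0) :
    πb' B₁ - πb' B₂ = c * rr * (B₂ - B₁) * (h + c * (K + 1)) / ((h + c * (K - B₁) * rr + c * (B₁ + 1)) * (h + c * (K - B₂) * rr + c * (B₂ + 1))) := by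
  rw [hπb', hπb', div_sub_div _ _ h1 h2]
  congr 1; ring

/-- Bounds: `0 ≤ π_b(B) ≤ cB/(h + cB) ≤ 1` and `0 ≤ π_b̄(B) ≤ rr·cK/(h + c)` for `0 ≤ B ≤ K` (`h > 0`, `c > 0`, `0 ≤ rr`). [ours] -/
theorem oneCopy_pi_bounds {h c rr K B : ℝ} {πb πb' : ℝ → ℝ} (hπb : ∀ B, πb B = c * B / (h + c * B + c * rr * (K - B + 1)))
    (hπb' : ∀ B, πb' B = c * (K - B) * rr / (h + c * (K - B) * rr + c * (B + 1)))
    (hh : 0 < h) (hc : 0 < c) (hrr : 0 ≤ rr) (hB0 : 0 ≤ B) (hBK : B ≤ K) :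
    (0 ≤ πb B ∧ πb B ≤ c * B / (h + c * B) ∧ πb B ≤ 1) ∧ (0 ≤ πb' B ∧ πb' B ≤ rr * (c * K) / (h + c)) := by
  have hd := oneCopy_den_pos (K := K) hh hc.le hrr hB0 (by linarith)
  have hx : 0 ≤ c * rr * (K - B + 1) := mul_nonneg (mul_nonneg hc.le hrr) (by linarith)
  have hd' : h + c ≤ h + c * (K - B) * rr + c * (B + 1) := by
    have : 0 ≤ c * (K - B) * rr := mul_nonneg (mul_nonneg hc.le (by linarith)) hrr
    nlinarith
  have hc' : 0 < h + c := by linarith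
  have hd'0 : 0 < h + c * (K - B) * rr + c * (B + 1) := lt_of_lt_of_le hc' hd'
  refine ⟨⟨?_, ?_, ?_⟩, ?_, ?_⟩
  · rw [hπb]; exact div_nonneg (by positivity) hd.le
  · rw [hπb]; exact div_le_div_of_nonneg_left (by positivity) (by nlinarith [mul_nonneg hc.le hB0]) (by linarith)
  · rw [hπb, div_le_one hd]; linarith [mul_nonneg hc.le hB0]
  · rw [hπb']; exact div_nonneg (mul_nonneg (mul_nonneg hc.le (by linarith)) hrr) hd'0.le
  · rw [hπb', div_le_div_iff₀ hd'0 hc']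
    have e1 : c * (K - B) * rr ≤ rr * (c * K) := by nlinarith [mul_nonneg hc.le hrr]
    calc c * (K - B) * rr * (h + c) ≤ rr * (c * K) * (h + c) := mul_le_mul_of_nonneg_right e1 hc'.le
      _ ≤ rr * (c * K) * (h + c * (K - B) * rr + c * (B + 1)) :=
          mul_le_mul_of_nonneg_left hd' (mul_nonneg hrr (mul_nonneg hc.le (by linarith)))

/-- **THE THREE-POINT IDENTITY** for the one-copy drift term: `q↓∇⁻φ − q↑∇⁺φ = (q↓ − q↑)·(∇⁺φ + ∇⁻φ)/2 − (q↓ + q↑)·(∇⁺φ − ∇⁻φ)/2` — drift times mean slope minus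
total step probability times half the second difference (the price of curvature). [ours] -/
theorem oneCopy_threePoint (qd qu gm gp : ℝ) : qd * gm - qu * gp = (qd - qu) * ((gp + gm) / 2) - (qd + qu) * ((gp - gm) / 2) := by ring

/-- **THE BUDGET FORM OF THE DRIFT INEQUALITY.**  If a per-count deficit `ℓ` bounds `ρφ(B) − d(B) ≤ ℓ(B)` for every natural `B ≤ K` (`d` the drift term) and the coupling
bracket pays `ρ(B₂ − B₁) + ℓ(B₁) + ℓ(B₂) ≤ μ[π_b(B₂) − π_b(B₁)] + μ̄[π_b̄(B₁) − π_b̄(B₂)]` for all naturals `B₁ < B₂ ≤ K`, then the drift inequality of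
`boolStar_mixingTime_le_of_oneCopyDrift` holds. [ours] -/
theorem oneCopyDrift_of_budget {K μb μb' ρ : ℝ} {πb πb' φ ℓ : ℝ → ℝ}
    (hℓ : ∀ B : ℕ, (B : ℝ) ≤ K → ρ * φ B - (μb * πb B * (φ B - φ (B - 1)) - μb' * πb' B * (φ (B + 1) - φ B)) ≤ ℓ B)
    (hG : ∀ B₁ B₂ : ℕ, B₁ + 1 ≤ B₂ → (B₂ : ℝ) ≤ K → ρ * ((B₂ : ℝ) - B₁) + ℓ B₁ + ℓ B₂ ≤ μb * (πb B₂ - πb B₁) + μb' * (πb' B₁ - πb' B₂))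
    (B₁ B₂ : ℕ) (h12 : B₁ + 1 ≤ B₂) (h2K : (B₂ : ℝ) ≤ K) :
    ρ * ((B₂ : ℝ) - B₁ + φ B₁ + φ B₂) ≤ μb * (πb B₂ - πb B₁) + μb' * (πb' B₁ - πb' B₂)
        + (μb * πb B₁ * (φ B₁ - φ (B₁ - 1)) - μb' * πb' B₁ * (φ (B₁ + 1) - φ B₁))
        + (μb * πb B₂ * (φ B₂ - φ (B₂ - 1)) - μb' * πb' B₂ * (φ (B₂ + 1) - φ B₂)) := by
  have h12' : (B₁ : ℝ) + 1 ≤ B₂ := by exact_mod_cast h12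
  have h1K : (B₁ : ℝ) ≤ K := by linarith
  have l1 := hℓ B₁ h1K
  have l2 := hℓ B₂ h2K
  have g := hG B₁ B₂ h12 h2K
  linarith

/-! ## §2 The one-copy drift `m = μ̄π_b̄ − μπ_b`: the coupling bracket is a drift difference, the gaps are explicit, positive and decreasing,
and `|m|` grows at least linearly away from its sign change -/

/-- **THE COUPLING BRACKET IS A DRIFT DIFFERENCE:** `μ[π_b(B₂) − π_b(B₁)] + μ̄[π_b̄(B₁) − π_b̄(B₂)] = m(B₁) − m(B₂)` for `m = μ̄π_b̄ − μπ_b` (the mean one-cycle increment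
of one copy's cold `b̄`-count): the expected change of `D = B_Y − B_X` is the difference of the two copies' drifts. [ours] -/
theorem oneCopy_bracket_eq_drift_sub {μb μb' B₁ B₂ : ℝ} {πb πb' m : ℝ → ℝ} (hm : ∀ B, m B = μb' * πb' B - μb * πb B) :
    μb * (πb B₂ - πb B₁) + μb' * (πb' B₁ - πb' B₂) = m B₁ - m B₂ := by rw [hm, hm]; ring

/-- **THE GAP** `g(B) = m(B) − m(B+1) = μ·c(h + c·rr(K+1))/(Δ(B)Δ(B+1)) + μ̄·c·rr(h + c(K+1))/(Δ(B+1)Δ(B+2))`, `Δ(B) = h + cB + c·rr(K−B+1)`. [ours] -/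
theorem oneCopy_gap_eq {h c rr K μb μb' B : ℝ} {πb πb' m : ℝ → ℝ} (hπb : ∀ B, πb B = c * B / (h + c * B + c * rr * (K - B + 1)))
    (hπb' : ∀ B, πb' B = c * (K - B) * rr / (h + c * (K - B) * rr + c * (B + 1))) (hm : ∀ B, m B = μb' * πb' B - μb * πb B)
    (hh : 0 < h) (hc : 0 ≤ c) (hrr : 0 ≤ rr) (hB0 : 0 ≤ B) (hBK : B + 1 ≤ K) :
    m B - m (B + 1) = μb * (c * (h + c * rr * (K + 1)) / ((h + c * B + c * rr * (K - B + 1)) * (h + c * (B + 1) + c * rr * (K - (B + 1) + 1))))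
      + μb' * (c * rr * (h + c * (K + 1)) / ((h + c * (B + 1) + c * rr * (K - (B + 1) + 1)) * (h + c * (B + 2) + c * rr * (K - (B + 2) + 1)))) := by
  have d0 := oneCopy_den_pos (K := K) (B := B) hh hc hrr hB0 (by linarith)
  have d1 := oneCopy_den_pos (K := K) (B := B + 1) hh hc hrr (by linarith) (by linarith)
  have d2 := oneCopy_den_pos (K := K) (B := B + 1 + 1) hh hc hrr (by linarith) (by linarith)
  have e1 := oneCopy_pib_sub (B₁ := B) (B₂ := B + 1) hπb d0.ne' d1.ne'
  have e2 := oneCopy_pib'_sub (B₁ := B) (B₂ := B + 1) hπb' (by rw [oneCopy_den_shift]; exact d1.ne') (by rw [oneCopy_den_shift]; exact d2.ne')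
  rw [← oneCopy_bracket_eq_drift_sub hm, e1, e2, oneCopy_den_shift h c rr K B, oneCopy_den_shift h c rr K (B + 1)]
  ring

/-- The gap is positive (`μ > 0`) — `m` is strictly decreasing. [ours] -/
theorem oneCopy_gap_pos {h c rr K μb μb' B : ℝ} {πb πb' m : ℝ → ℝ} (hπb : ∀ B, πb B = c * B / (h + c * B + c * rr * (K - B + 1)))
    (hπb' : ∀ B, πb' B = c * (K - B) * rr / (h + c * (K - B) * rr + c * (B + 1))) (hm : ∀ B, m B = μb' * πb' B - μb * πb B)
    (hh : 0 < h) (hc : 0 < c) (hrr : 0 ≤ rr) (hμb : 0 < μb) (hμb' : 0 ≤ μb') (hB0 : 0 ≤ B) (hBK : B + 1 ≤ K) :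
    0 < m B - m (B + 1) := by
  rw [oneCopy_gap_eq hπb hπb' hm hh hc.le hrr hB0 hBK]
  have d0 := oneCopy_den_pos (K := K) (B := B) hh hc.le hrr hB0 (by linarith)
  have d1 := oneCopy_den_pos (K := K) (B := B + 1) hh hc.le hrr (by linarith) (by linarith)
  have d2 := oneCopy_den_pos (K := K) (B := B + 2) hh hc.le hrr (by linarith) (by linarith)
  have hK : 0 ≤ K + 1 := by linarith
  have t1 : 0 < μb * (c * (h + c * rr * (K + 1)) / ((h + c * B + c * rr * (K - B + 1)) * (h + c * (B + 1) + c * rr * (K - (B + 1) + 1)))) := by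
    apply mul_pos hμb; apply div_pos _ (mul_pos d0 d1)
    have : 0 ≤ c * rr * (K + 1) := by positivity
    nlinarith
  have t2 : 0 ≤ μb' * (c * rr * (h + c * (K + 1)) / ((h + c * (B + 1) + c * rr * (K - (B + 1) + 1)) * (h + c * (B + 2) + c * rr * (K - (B + 2) + 1)))) := by
    apply mul_nonneg hμb'; apply div_nonneg _ (mul_pos d1 d2).le
    have : 0 ≤ c * (K + 1) := by positivity
    have : 0 ≤ c * rr := by positivity
    nlinarith
  linarith

/-- The gap is decreasing in `B` (the denominators `Δ` increase). [ours] -/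
theorem oneCopy_gap_antitone {h c rr K μb μb' B : ℝ} {πb πb' m : ℝ → ℝ} (hπb : ∀ B, πb B = c * B / (h + c * B + c * rr * (K - B + 1)))
    (hπb' : ∀ B, πb' B = c * (K - B) * rr / (h + c * (K - B) * rr + c * (B + 1))) (hm : ∀ B, m B = μb' * πb' B - μb * πb B)
    (hh : 0 < h) (hc : 0 ≤ c) (hrr0 : 0 ≤ rr) (hrr1 : rr ≤ 1) (hμb : 0 ≤ μb) (hμb' : 0 ≤ μb') (hB0 : 0 ≤ B) (hBK : B + 2 ≤ K) :
    m (B + 1) - m (B + 1 + 1) ≤ m B - m (B + 1) := by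
  rw [oneCopy_gap_eq hπb hπb' hm hh hc hrr0 hB0 (by linarith), oneCopy_gap_eq hπb hπb' hm hh hc hrr0 (by linarith) (by linarith)]
  have d0 := oneCopy_den_pos (K := K) (B := B) hh hc hrr0 hB0 (by linarith)
  have d1 := oneCopy_den_pos (K := K) (B := B + 1) hh hc hrr0 (by linarith) (by linarith)
  have d2 := oneCopy_den_pos (K := K) (B := B + 1 + 1) hh hc hrr0 (by linarith) (by linarith)
  have d3 := oneCopy_den_pos (K := K) (B := B + 1 + 2) hh hc hrr0 (by linarith) (by linarith)
  have hK : 0 ≤ K + 1 := by linarith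
  have n1 : 0 ≤ c * (h + c * rr * (K + 1)) := by positivity
  have n2 : 0 ≤ c * rr * (h + c * (K + 1)) := by positivity
  -- `Δ(B) ≤ Δ(B+1) ≤ Δ(B+2) ≤ Δ(B+3)`
  have step : ∀ X : ℝ, h + c * X + c * rr * (K - X + 1) ≤ h + c * (X + 1) + c * rr * (K - (X + 1) + 1) := fun X => by
    have : 0 ≤ c * (1 - rr) := mul_nonneg hc (by linarith)
    nlinarith
  have i01 := step B
  have i12 : h + c * (B + 1) + c * rr * (K - (B + 1) + 1) ≤ h + c * (B + 1 + 1) + c * rr * (K - (B + 1 + 1) + 1) := step (B + 1)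
  have i23 : h + c * (B + 2) + c * rr * (K - (B + 2) + 1) ≤ h + c * (B + 1 + 2) + c * rr * (K - (B + 1 + 2) + 1) := by
    have := step (B + 2); rw [show B + 2 + 1 = B + 1 + 2 by ring] at this; exact this
  have e22 : h + c * (B + 2) + c * rr * (K - (B + 2) + 1) = h + c * (B + 1 + 1) + c * rr * (K - (B + 1 + 1) + 1) := by ring
  have t1 : c * (h + c * rr * (K + 1)) / ((h + c * (B + 1) + c * rr * (K - (B + 1) + 1)) * (h + c * (B + 1 + 1) + c * rr * (K - (B + 1 + 1) + 1)))
      ≤ c * (h + c * rr * (K + 1)) / ((h + c * B + c * rr * (K - B + 1)) * (h + c * (B + 1) + c * rr * (K - (B + 1) + 1))) := by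
    apply div_le_div_of_nonneg_left n1 (mul_pos d0 d1)
    calc (h + c * B + c * rr * (K - B + 1)) * (h + c * (B + 1) + c * rr * (K - (B + 1) + 1))
        ≤ (h + c * (B + 1) + c * rr * (K - (B + 1) + 1)) * (h + c * (B + 1) + c * rr * (K - (B + 1) + 1)) := mul_le_mul_of_nonneg_right i01 d1.le
      _ ≤ (h + c * (B + 1) + c * rr * (K - (B + 1) + 1)) * (h + c * (B + 1 + 1) + c * rr * (K - (B + 1 + 1) + 1)) := mul_le_mul_of_nonneg_left i12 d1.le
  have t2 : c * rr * (h + c * (K + 1)) / ((h + c * (B + 1 + 1) + c * rr * (K - (B + 1 + 1) + 1)) * (h + c * (B + 1 + 2) + c * rr * (K - (B + 1 + 2) + 1)))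
      ≤ c * rr * (h + c * (K + 1)) / ((h + c * (B + 1) + c * rr * (K - (B + 1) + 1)) * (h + c * (B + 2) + c * rr * (K - (B + 2) + 1))) := by
    rw [e22]
    apply div_le_div_of_nonneg_left n2 (mul_pos d1 d2)
    calc (h + c * (B + 1) + c * rr * (K - (B + 1) + 1)) * (h + c * (B + 1 + 1) + c * rr * (K - (B + 1 + 1) + 1))
        ≤ (h + c * (B + 1 + 1) + c * rr * (K - (B + 1 + 1) + 1)) * (h + c * (B + 1 + 1) + c * rr * (K - (B + 1 + 1) + 1)) := mul_le_mul_of_nonneg_right i12 d2.le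
      _ ≤ (h + c * (B + 1 + 1) + c * rr * (K - (B + 1 + 1) + 1)) * (h + c * (B + 1 + 2) + c * rr * (K - (B + 1 + 2) + 1)) := by
          rw [← e22]; exact mul_le_mul_of_nonneg_left i23 (by rw [e22]; exact d2.le)
  have := mul_le_mul_of_nonneg_left t1 hμb
  have := mul_le_mul_of_nonneg_left t2 hμb'
  linarith

/-- **`|m|` GROWS AT LEAST LINEARLY ABOVE ITS SIGN CHANGE:** if `m(B₀ + 1) ≤ 0` then for every natural `n` with `B₀ + 1 + n ≤ K − 1`... precisely with `B₀ + 2 + n ≤ K`: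
`−m(B₀ + 1 + n) ≥ −m(B₀ + 1) + n·g(B₀ + n)` where `g(B) = m(B) − m(B+1)` (each of the `n` gaps crossed is at least the last one). [ours] -/
theorem oneCopy_drift_le_above {h c rr K μb μb' B₀ : ℝ} {πb πb' m : ℝ → ℝ} (hπb : ∀ B, πb B = c * B / (h + c * B + c * rr * (K - B + 1)))
    (hπb' : ∀ B, πb' B = c * (K - B) * rr / (h + c * (K - B) * rr + c * (B + 1))) (hm : ∀ B, m B = μb' * πb' B - μb * πb B)
    (hh : 0 < h) (hc : 0 ≤ c) (hrr0 : 0 ≤ rr) (hrr1 : rr ≤ 1) (hμb : 0 ≤ μb) (hμb' : 0 ≤ μb') (hB0 : 0 ≤ B₀)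
    (n : ℕ) (hn : B₀ + 2 + n ≤ K) :
    m (B₀ + 1 + n) ≤ m (B₀ + 1) - n * (m (B₀ + n) - m (B₀ + n + 1)) := by
  induction n with
  | zero => simp
  | succ k ih =>
    have hk : B₀ + 2 + (k : ℝ) ≤ K := by push_cast at hn; linarith
    have ih' := ih hk
    -- the last gap `g(B₀+1+k)` and the monotonicity `g(B₀+1+k) ≤ g(B₀+k)`
    have anti := oneCopy_gap_antitone (B := B₀ + k) hπb hπb' hm hh hc hrr0 hrr1 hμb hμb' (by positivity) (by push_cast at hn; linarith)
    push_cast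
    rw [show B₀ + 1 + ((k : ℝ) + 1) = B₀ + k + 1 + 1 by ring, show B₀ + ((k : ℝ) + 1) = B₀ + k + 1 by ring]
    rw [show B₀ + 1 + (k : ℝ) = B₀ + k + 1 by ring] at ih'
    rw [show B₀ + (k : ℝ) + 1 = B₀ + k + 1 by ring] at ih' anti
    nlinarith [anti, ih']

/-- **… AND BELOW IT:** for every natural `n` with `n ≤ B₀`, `B₀ + 1 ≤ K`: `m(B₀ − n) ≥ m(B₀) + n·g(B₀)`. [ours] -/
theorem oneCopy_drift_ge_below {h c rr K μb μb' B₀ : ℝ} {πb πb' m : ℝ → ℝ} (hπb : ∀ B, πb B = c * B / (h + c * B + c * rr * (K - B + 1)))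
    (hπb' : ∀ B, πb' B = c * (K - B) * rr / (h + c * (K - B) * rr + c * (B + 1))) (hm : ∀ B, m B = μb' * πb' B - μb * πb B)
    (hh : 0 < h) (hc : 0 ≤ c) (hrr0 : 0 ≤ rr) (hrr1 : rr ≤ 1) (hμb : 0 ≤ μb) (hμb' : 0 ≤ μb') (hBK : B₀ + 1 ≤ K)
    (n : ℕ) (hn : (n : ℝ) ≤ B₀) :
    m B₀ + n * (m B₀ - m (B₀ + 1)) ≤ m (B₀ - n) := by
  induction n with
  | zero => simp
  | succ k ih =>
    have hk : (k : ℝ) ≤ B₀ := by push_cast at hn; linarith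
    have ih' := ih hk
    -- the gap `g(B₀ − k − 1) ≥ g(B₀ − k) ≥ … ≥ g(B₀)`: by antitonicity iterated — here one step plus the inductive bookkeeping via `ih`
    have gk : m B₀ - m (B₀ + 1) ≤ m (B₀ - (k + 1)) - m (B₀ - (k + 1) + 1) := by
      -- iterate antitonicity from `B₀ − (k+1)` up to `B₀`
      have main : ∀ j : ℕ, (j : ℝ) ≤ k + 1 → m (B₀ - (k + 1) + j) - m (B₀ - (k + 1) + j + 1) ≤ m (B₀ - (k + 1)) - m (B₀ - (k + 1) + 1) := by
        intro j hj
        induction j with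
        | zero => simp
        | succ i ihi =>
          have hi : (i : ℝ) ≤ k + 1 := by push_cast at hj; linarith
          have a := oneCopy_gap_antitone (B := B₀ - (k + 1) + i) hπb hπb' hm hh hc hrr0 hrr1 hμb hμb'
            (by push_cast at hn; linarith) (by push_cast at hj hn; linarith)
          push_cast
          rw [show B₀ - ((k : ℝ) + 1) + ((i : ℝ) + 1) = B₀ - (k + 1) + i + 1 by ring]
          exact a.trans (ihi hi)
      have := main (k + 1) (by push_cast; linarith)
      push_cast at this
      rw [show B₀ - ((k : ℝ) + 1) + ((k : ℝ) + 1) = B₀ by ring] at this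
      exact this
    push_cast
    rw [show B₀ - ((k : ℝ) + 1) = B₀ - k - 1 by ring] at gk ⊢
    rw [show B₀ - (k : ℝ) - 1 + 1 = B₀ - k by ring] at gk
    nlinarith [ih', gk]

/-! ## §3 The law from a drift inequality for a potential given on the INTEGERS only (McShane extension) -/

section Law
open Finset Function Matrix
open Literature.Probability.MarkovChains

variable {K m : ℕ} {μ : Fin (K + 1) → Bool → ℝ} {M : Fin (K + 1) → Bool → Bool → ℝ} {w : Fin (K + 1) → ℝ} {t : ℝ}
variable (κ : Fin m → Fin K)

/-- **`boolStar_mixingTime_le_of_oneCopyDrift` WITH `φ` CONSTRAINED ON THE INTEGERS ONLY.**  The drift inequality of S9 evaluates `φ` only at integer points, and a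
function `φ ≥ 0`, `1`-Lipschitz ON `ℤ` is the restriction of a function `≥ 0`, `1`-Lipschitz on `ℝ` (McShane extension, then `max{·,0}`); so the law of S9 holds for any
`φ : ℝ → ℝ` with `0 ≤ φ(n)`, `|φ(n) − φ(m)| ≤ |n − m|` for integers `n, m`, `φ(n) ≤ Φm` for naturals `n ≤ K`, and the drift inequality — in particular for potentials
defined recursively along the count (second differences prescribed by the local gaps of the drift, memo §19–§20). [ours] -/
theorem boolStar_mixingTime_le_of_oneCopyDrift_int (hm : 1 ≤ m) (ht0 : 0 < t) (ht1 : t < 1) (hw0 : ∀ k, 0 ≤ w k) (hw00 : 0 < w 0)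
    (hw1 : ∑ k, w k = 1) (hμ : ∀ k x, 0 < μ k x) (hμ1 : ∀ k, ∑ u, μ k u = 1) (hM0 : ∀ u v, M 0 u v = μ 0 v)
    (hidle : ∀ i : Fin K, ∀ u v, M i.succ u v = if v = u then 1 else 0) (hhom : ∀ i : Fin K, μ i.succ = μ 1)
    {c0 : ℕ} (hunif : ∀ i : Fin K, (univ.filter fun r : Fin m => κ r = i).card = c0)
    {b : Bool} (hb : μ 0 b * μ 1 (!b) ≤ μ 0 (!b) * μ 1 b) {rr : ℝ} (hrr : rr = μ 0 b * μ 1 (!b) / (μ 0 (!b) * μ 1 b))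
    {φ : ℝ → ℝ} (hφ0 : ∀ n : ℤ, 0 ≤ φ n) (hφ : ∀ n n' : ℤ, |φ n - φ n'| ≤ |(n : ℝ) - n'|) {Φm : ℝ} (hφm : ∀ n : ℕ, n ≤ K → φ n ≤ Φm)
    {πb πb' : ℝ → ℝ} (hπb : ∀ B, πb B = t / K * B / ((1 - t) * w 0 + t / K * B + t / K * rr * (K - B + 1)))
    (hπb' : ∀ B, πb' B = t / K * (K - B) * rr / ((1 - t) * w 0 + t / K * (K - B) * rr + t / K * (B + 1)))
    {ρ : ℝ} (hρ0 : 0 < ρ) (hρ1 : ρ ≤ 1)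
    (h1D : ∀ B₁ B₂ : ℕ, B₁ + 1 ≤ B₂ → B₂ ≤ K →
      ρ * ((B₂ : ℝ) - B₁ + φ B₁ + φ B₂) ≤ μ 0 b * (πb B₂ - πb B₁) + μ 0 (!b) * (πb' B₁ - πb' B₂)
        + (μ 0 b * πb B₁ * (φ B₁ - φ (B₁ - 1)) - μ 0 (!b) * πb' B₁ * (φ (B₁ + 1) - φ B₁))
        + (μ 0 b * πb B₂ * (φ B₂ - φ (B₂ - 1)) - μ 0 (!b) * πb' B₂ * (φ (B₂ + 1) - φ B₂)))
    {ε : ℝ} (hε : 0 < ε) :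
    mixingTime (fun y z : Fin (K + 1) → Bool =>
        t * ptGraphSwap μ (fun r : Fin m => (((0 : Fin (K + 1)), (κ r).succ) : Fin (K + 1) × Fin (K + 1))) (fun _ : Fin m => Equiv.refl Bool) y z
          + (1 - t) * prodKernel w M y z) (tensorFun μ) ε
      ≤ ⌈1 / ((1 - t) * w 0 * ρ / 4) * Real.log ((Real.exp 1 * (K + 2 * Φm) + 1) / ε)⌉₊ := by
  -- McShane: extend `φ|ℤ` to a `1`-Lipschitz function on `ℝ`, then take the positive part
  have hL : LipschitzOnWith 1 φ (Set.range (Int.cast : ℤ → ℝ)) :=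
    LipschitzOnWith.mk_one (by
      rintro x ⟨n, rfl⟩ y ⟨n', rfl⟩
      rw [Real.dist_eq, Real.dist_eq]; exact hφ n n')
  obtain ⟨g, hg, hEq⟩ := hL.extend_real
  have hψL : ∀ x y, |max (g x) 0 - max (g y) 0| ≤ |x - y| := fun x y => by
    have := (hg.max_const 0).dist_le_mul x y
    simpa [Real.dist_eq] using this
  have hψ0 : ∀ x, 0 ≤ max (g x) 0 := fun x => le_max_right _ _
  have hψφ : ∀ n : ℤ, max (g n) 0 = φ n := fun n => by
    rw [← hEq ⟨n, rfl⟩]; exact max_eq_left (hφ0 n)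
  have key : ∀ B : ℕ, max (g B) 0 = φ B ∧ max (g ((B : ℝ) - 1)) 0 = φ ((B : ℝ) - 1) ∧ max (g ((B : ℝ) + 1)) 0 = φ ((B : ℝ) + 1) := by
    intro B
    refine ⟨?_, ?_, ?_⟩
    · have := hψφ B; push_cast at this; exact this
    · have := hψφ (B - 1); push_cast at this; exact this
    · have := hψφ (B + 1); push_cast at this; exact this
  have hψm : ∀ n : ℕ, n ≤ K → max (g n) 0 ≤ Φm := fun n hn => by rw [(key n).1]; exact hφm n hn
  refine boolStar_mixingTime_le_of_oneCopyDrift κ hm ht0 ht1 hw0 hw00 hw1 hμ hμ1 hM0 hidle hhom hunif hb hrr (φ := fun x => max (g x) 0)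
    hψ0 hψL hψm hπb hπb' hρ0 hρ1 (fun B₁ B₂ h12 h2K => ?_) hε
  obtain ⟨a1, a2, a3⟩ := key B₁
  obtain ⟨b1, b2, b3⟩ := key B₂
  simp only [a1, a2, a3, b1, b2, b3]
  exact h1D B₁ B₂ h12 h2K

end Law

end Summit.Ventures.LatticeQCDFlow.Scaling

end
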